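import Mathlib
import Summits.Langlands.Langlands.Theorems.IrreducibilityBySelfDualityIrreducibleOffSectorSolvablePrimeIndex
import Summits.Langlands.Langlands.Theorems.SmithKummerSeedAscentConjugationSolvableSplit

/-!
# Stub `stub_primeTowerInduction` (line `registered`, crux `BaseFieldAscent.AscentConjugationSolvable`,
stmt-Langlands-1094)

Pure Galois theory: the PRIME-STEP TOWER PRINCIPLE for number fields.  A property `P` of number fields
that climbs every Galois layer `L/K` of PRIME degree (`P K → P L`) climbs every finite Galois extension
`E/K` of number fields whose Galois group is SOLVABLE and whose degree is `> 1`.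

Proof (strong induction on `d = [E:K]` over all base fields `K`), through the landed Galois-theoretic step
`AscentConjugationSolvableSplit.galois_prime_step`: `Gal(E/K)` is finite, non-trivial (`1 < [E:K]`) and
solvable, so it has a normal subgroup `N` of prime index
(`IrreducibleOffSector.exists_normal_prime_index_of_isSolvable`); either `N = ⊥` and `[E:K]` is prime —
one prime step `K → E` — or the fixed field `M = E^N` is Galois of prime degree over `K`, `E/M` is Galois
with group `≃ N` (solvable) and `1 < [E:M] < [E:K]` — one prime step `K → M` followed by the induction
hypothesis at the smaller degree `[E:M]` (`NumberField M := NumberField.of_module_finite K M`).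

* `tower_induction` — the degree-indexed form (solvability as an instance);
* `stub_primeTowerInduction` — the registered signature (solvability as an explicit hypothesis).

References: folklore (solvable Galois theory; e.g. D. J. S. Robinson, *A course in the theory of groups*
(1996), 5.4.8 for the group-theoretic step).
-/

set_option linter.dupNamespace false -- mandated Summit.Langlands.Langlands namespace (D-0017)

noncomputable section

open Summit.Langlands.Langlands.Theorems.AscentConjugationSolvableSplit

namespace Summit.Langlands.Langlands.Theorems.BaseFieldAscentAscentConjugationSolvable

-- adapted from Cruxes/AscentConjugationSolvable/Split.lean (`recip_ascent_of_isSolvable`), for an arbitrary `P`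

/-- **Tower induction, degree-indexed form.**  If `P` climbs every Galois layer of prime degree, then for
every `d`, every finite Galois extension `T/K` of number fields with solvable group and `[T:K] = d > 1`
satisfies `P K → P T`.  Strong induction on `d` over all base fields through `galois_prime_step`: a prime
degree is one layer; otherwise climb to the intermediate `M` (one prime layer) and recurse into `T/M`, of
smaller degree `> 1`. [folklore] -/
theorem tower_induction (P : (K : Type) → [Field K] → [NumberField K] → Prop)
    (hstep : ∀ (K L : Type) [Field K] [NumberField K] [Field L] [NumberField L] [Algebra K L]
      [IsGalois K L], (Module.finrank K L).Prime → P K → P L) :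
    ∀ (d : ℕ) (K T : Type) [Field K] [NumberField K] [Field T] [NumberField T] [Algebra K T]
      [IsGalois K T] [IsSolvable (T ≃ₐ[K] T)], Module.finrank K T = d → 1 < d → P K → P T := by
  intro d
  induction d using Nat.strong_induction_on with
  | _ d ih =>
    intro K T _ _ _ _ _ _ _ hd hlt hK
    rcases galois_prime_step K T (hd ▸ hlt) with hprime | ⟨M, hGal, hpM, hsolv, h1, hltM⟩
    · exact hstep K T (hd ▸ hprime) hK
    · haveI := hGal
      haveI := hsolv
      haveI : FiniteDimensional K T := Module.Finite.of_restrictScalars_finite ℚ K T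
      haveI : NumberField M := NumberField.of_module_finite K M
      exact ih (Module.finrank M T) (hd ▸ hltM) M T rfl h1 (hstep K M hpM hK)

/-- **STUB `stub_primeTowerInduction` — the prime-step tower principle.**  A property of number fields that
passes UP every Galois layer of PRIME degree passes up every finite Galois extension `E/K` of number fields
with SOLVABLE Galois group and degree `> 1` (`tower_induction` at `d = [E:K]`, with the solvability
hypothesis promoted to an instance). [folklore] -/
theorem stub_primeTowerInduction :
    ∀ (P : (K : Type) → [Field K] → [NumberField K] → Prop),
      (∀ (K L : Type) [Field K] [NumberField K] [Field L] [NumberField L] [Algebra K L]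
          [IsGalois K L], (Module.finrank K L).Prime → P K → P L) →
      ∀ (K E : Type) [Field K] [NumberField K] [Field E] [NumberField E] [Algebra K E]
        [IsGalois K E], IsSolvable (E ≃ₐ[K] E) → 1 < Module.finrank K E → P K → P E := by
  intro P hstep K E _ _ _ _ _ _ hsolv hlt hK
  haveI := hsolv
  exact tower_induction P hstep (Module.finrank K E) K E rfl hlt hK

end Summit.Langlands.Langlands.Theorems.BaseFieldAscentAscentConjugationSolvable

end
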